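import Summits.QuantumAdvantage.QuantumAdvantage.Theorems.LinnikCubicClassGroupsDegreeOnePrimesEscapeFrobeniusSmoothedSigned
import Summits.QuantumAdvantage.QuantumAdvantage.Theorems.LinnikCubicClassGroupsDegreeOnePrimesEscapeFrobeniusPsi
import Summits.QuantumAdvantage.QuantumAdvantage.Theorems.LinnikCubicClassGroupsDegreeOnePrimesEscapeClassPNTDHTheta
import HarnessLib

/-!
# The Chebotarev prime number theorem for a cyclic extension in the Linnik range, `ψ`-form, WITH THE SIGN

Topic `Summits/QuantumAdvantage/QuantumAdvantage/Theorems`, cell B2b-1 (linnik-cubic), PART A (gen 13); helper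
toward the crux `DegreeOnePrimesEscape` (stmt-QuantumAdvantage-11543) — step B6 of the LMO programme for
conjugacy classes inside a division.  HONEST FRAMING: the value of this file is a THEOREM (kernel-checked,
GRH-free) — NOT summit progress.

**Theorem** (`frobeniusPsi_dichotomy_signed`).  As `frobeniusPsi_dichotomy` (`…FrobeniusPsi.lean`, gen 12):
for `n > 1`, `η > 0` there are `a₂ ≥ 1`, `0 < c ≤ 1/(8(n²+1))` and a second window constant `0 < c' ≤ c`
such that for every cyclic `N|E` with `[N:ℚ] = n`, `1 < [E:ℚ]`, `m = [N:E]`, there is a faithful character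
`χ₁` of `Gal(N|E)` with, for `ψ_τ(x) = Σ_{N𝔭^k ≤ x, 𝔭 unramified in N, Frob_𝔭^k = τ} log N𝔭`, `Q = |d_N| nⁿ`,
all `x ≥ Q^{a₂}` and all `τ`: (A) no real zero of `ζ₁_N` in the `c`-window ⟹ `|m ψ_τ(x) − x| ≤ η x`;
(B) `β₁` such a zero ⟹ `|m ψ_τ(x) − (x − Re(χ₁(τ)^{−j₀}) x^{β₁}/β₁)| ≤ η x min(1, (1 − β₁) log x)` for some
`j₀ < m`; and the new clause (B'): if `β₁` lies in the `c'`-window then moreover `j₀ = 0 ↔ ζ₁_E(β₁) = 0`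
and `(χ₁(τ)^{j₀})² = 1` for all `τ` (the coefficient is `±1`: the exceptional character is REAL,
[LagariasMontgomeryOdlyzko1979, Thm. 1.1]).  Proof: `smoothedFrobenius_dichotomy_signed` + the unsmoothing of
`…FrobeniusPsi.lean` verbatim.
References: [LagariasMontgomeryOdlyzko1979, §§3, 7]; [ThornerZaman2019, Thm. 1.4]; [Weiss1983, Thm. 5.2].
-/

noncomputable section

open Complex Real Finset NumberField IsDedekindDomain
open scoped NumberField nonZeroDivisors Classical

namespace Summit.QuantumAdvantage.QuantumAdvantage.Theorems.DegreeOnePrimesEscape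

open Literature.NumberTheory.LFunctions Literature.NumberTheory.LFunctions.NumberField
  Literature.NumberTheory.LFunctions.EntireEF Literature.NumberTheory.LFunctions.TZWeight
  Literature.NumberTheory.LFunctions.AbelianDensity Literature.NumberTheory.GaloisRepresentations

set_option maxHeartbeats 3200000 in
/-- **The Chebotarev prime number theorem for a cyclic extension in the Linnik range, `ψ`-form, two-sided, with
the exceptional zero of `ζ_N` and the SIGN of its coefficient** (see the module docstring).
[cite: LagariasMontgomeryOdlyzko1979, §7, Theorem 1.1] [cite: ThornerZaman2019, Theorem 1.4] -/
theorem frobeniusPsi_dichotomy_signed (n₀ : ℕ) (hn₀ : 1 < n₀) {η : ℝ} (hη : 0 < η) :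
    ∃ a₂ c c' : ℝ, 1 ≤ a₂ ∧ 0 < c ∧ c ≤ 1 / (8 * ((n₀ : ℝ) ^ 2 + 1)) ∧ 0 < c' ∧ c' ≤ c ∧
    ∀ (E N : Type) [Field E] [NumberField E] [Field N] [NumberField N] [Algebra E N] [IsGalois E N]
      [IsCyclic (N ≃ₐ[E] N)], Module.finrank ℚ N = n₀ → 1 < Module.finrank ℚ E →
    ∃ χ₁ : (N ≃ₐ[E] N) →* ℂˣ, Function.Injective χ₁ ∧
      (∀ (τ : N ≃ₐ[E] N) (wτ : Ideal (𝓞 E) → ℝ),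
        (∀ I, wτ I = if (∃ v : HeightOneSpectrum (𝓞 E), Algebra.IsUnramifiedIn (𝓞 N) v.asIdeal ∧
          ∃ k : ℕ, I = v.asIdeal ^ k ∧ galFrob E N v ^ k = τ) then 1 else 0) →
        ∀ x : ℝ, ThornerZaman.condQn N ^ a₂ ≤ x →
          (¬ ∃ β₁ : ℝ, dedekindZeta₁ N β₁ = 0 ∧
            1 - c / (Real.log ((NumberField.discr N).natAbs : ℝ) + Real.log 4) < β₁ ∧ β₁ < 1) →
          |(Module.finrank E N : ℝ) * (∑ n ∈ Icc 0 ⌊x⌋₊, ∑ I ∈ idealsOfNorm E n, wτ I * idealVonMangoldt I) - x| ≤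
            η * x) ∧
      (∀ β₁ : ℝ, dedekindZeta₁ N β₁ = 0 →
          1 - c / (Real.log ((NumberField.discr N).natAbs : ℝ) + Real.log 4) < β₁ → β₁ < 1 →
        ∃ j₀ : ℕ, j₀ < Module.finrank E N ∧
        ∀ (τ : N ≃ₐ[E] N) (wτ : Ideal (𝓞 E) → ℝ),
          (∀ I, wτ I = if (∃ v : HeightOneSpectrum (𝓞 E), Algebra.IsUnramifiedIn (𝓞 N) v.asIdeal ∧
            ∃ k : ℕ, I = v.asIdeal ^ k ∧ galFrob E N v ^ k = τ) then 1 else 0) →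
          ∀ x : ℝ, ThornerZaman.condQn N ^ a₂ ≤ x →
            |(Module.finrank E N : ℝ) * (∑ n ∈ Icc 0 ⌊x⌋₊, ∑ I ∈ idealsOfNorm E n, wτ I * idealVonMangoldt I) -
                (x - ((((χ₁ τ : ℂˣ) : ℂ)⁻¹) ^ j₀).re * x ^ β₁ / β₁)| ≤
              η * x * min 1 ((1 - β₁) * Real.log x)) ∧
      (∀ β₁ : ℝ, dedekindZeta₁ N β₁ = 0 →
          1 - c' / (Real.log ((NumberField.discr N).natAbs : ℝ) + Real.log 4) < β₁ → β₁ < 1 →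
        ∃ j₀ : ℕ, j₀ < Module.finrank E N ∧ (j₀ = 0 ↔ dedekindZeta₁ E β₁ = 0) ∧
        (∀ τ : N ≃ₐ[E] N, ((((χ₁ τ : ℂˣ) : ℂ)) ^ j₀) ^ 2 = 1) ∧
        ∀ (τ : N ≃ₐ[E] N) (wτ : Ideal (𝓞 E) → ℝ),
          (∀ I, wτ I = if (∃ v : HeightOneSpectrum (𝓞 E), Algebra.IsUnramifiedIn (𝓞 N) v.asIdeal ∧
            ∃ k : ℕ, I = v.asIdeal ^ k ∧ galFrob E N v ^ k = τ) then 1 else 0) →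
          ∀ x : ℝ, ThornerZaman.condQn N ^ a₂ ≤ x →
            |(Module.finrank E N : ℝ) * (∑ n ∈ Icc 0 ⌊x⌋₊, ∑ I ∈ idealsOfNorm E n, wτ I * idealVonMangoldt I) -
                (x - ((((χ₁ τ : ℂˣ) : ℂ)⁻¹) ^ j₀).re * x ^ β₁ / β₁)| ≤
              η * x * min 1 ((1 - β₁) * Real.log x)) := by
  classical
  have hη4 : 0 < η / 4 := by positivity
  obtain ⟨ν, a₁, c, c', hν0, hν64, ha₁1, hc, hcn, hc'0, hc'c, hmain⟩ := smoothedFrobenius_dichotomy_signed n₀ hn₀ hη4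
  obtain ⟨c₁, hc₁, hc₁1, heff⟩ := Residue.one_sub_realZero_ge_condQn_rpow n₀ hn₀
  have hn2 : (2 : ℝ) ≤ n₀ := by exact_mod_cast hn₀
  -- thresholds
  set Λu : ℝ := max 0 (Real.log (176 * ((n₀ : ℝ) + 1) / (ν * η * c₁))) with hΛu
  have hΛu0 : 0 ≤ Λu := le_max_left _ _
  set Λm : ℝ := max 0 (Real.log (64 / (η * c₁))) with hΛm
  have hΛm0 : 0 ≤ Λm := le_max_left _ _
  set ΛJ : ℝ := max 0 (Real.log (64 * n₀ / (ν * η * c₁))) with hΛJ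
  have hΛJ0 : 0 ≤ ΛJ := le_max_left _ _
  set a₂ : ℝ := max (max a₁ ((3 + ΛJ) / (1 - ν))) (max (2 * (Λu + 6) / ν) ((2 + Λm) / ν)) with ha₂
  have ha₂a₁ : a₁ ≤ a₂ := le_trans (le_max_left _ _) (le_max_left _ _)
  have ha₂J : (3 + ΛJ) / (1 - ν) ≤ a₂ := le_trans (le_max_right _ _) (le_max_left _ _)
  have ha₂u : 2 * (Λu + 6) / ν ≤ a₂ := le_trans (le_max_left _ _) (le_max_right _ _)
  have ha₂m : (2 + Λm) / ν ≤ a₂ := le_trans (le_max_right _ _) (le_max_right _ _)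
  have ha₂1 : 1 ≤ a₂ := le_trans ha₁1 ha₂a₁
  refine ⟨a₂, c, c', ha₂1, hc, hcn, hc'0, hc'c, ?_⟩
  intro E N _ _ _ _ _ _ _ hNn hE
  obtain ⟨χ₁, hχ₁, hcaseA, hcaseB, hcaseB'⟩ := hmain E N hNn hE
  haveI : FiniteDimensional E N := Module.Finite.of_restrictScalars_finite ℚ E N
  have hN : 1 < Module.finrank ℚ N := by rw [hNn]; exact hn₀
  set mN : ℕ := Module.finrank E N with hmN
  have hdeg : Module.finrank ℚ N = Module.finrank ℚ E * mN := (Module.finrank_mul_finrank ℚ E N).symm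
  have hm0 : (0 : ℝ) ≤ mN := Nat.cast_nonneg _
  set Q : ℝ := ThornerZaman.condQn N with hQ
  have hQ12 : (12 : ℝ) ≤ Q := ThornerZaman.twelve_le_condQn (K := N) hN
  have hQ1 : (1 : ℝ) < Q := by linarith
  have hQ0 : (0 : ℝ) < Q := by linarith
  have hlogQ : 2 ≤ Real.log Q := two_lt_log_twelve.le.trans (Real.log_le_log (by norm_num) hQ12)
  have hlogQ1 : 1 ≤ Real.log Q := by linarith
  have hQm2 : Q ^ (-(2 : ℝ)) ≤ 1 := Real.rpow_le_one_of_one_le_of_nonpos hQ1.le (by norm_num)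
  have hQm2' : 0 < Q ^ (-(2 : ℝ)) := Real.rpow_pos_of_pos hQ0 _
  set m' : ℝ := c₁ * Q ^ (-(2 : ℝ)) with hm'
  have hm'0 : 0 < m' := mul_pos hc₁ hQm2'
  have hm'1 : m' ≤ 1 := (mul_le_mul hc₁1 hQm2 hQm2'.le zero_le_one).trans (by norm_num)
  have hm'2 : m' = c₁ * (Q ^ 2)⁻¹ := by rw [hm', Real.rpow_neg hQ0.le, Real.rpow_two]
  -- `ω(d_N) ≤ 2Q`
  have hω : (((NumberField.discr N).natAbs.primeFactors.card : ℕ) : ℝ) ≤ 2 * Q := by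
    -- `ω(d) ≤ d ≤ Q`
    have h1 : (NumberField.discr N).natAbs.primeFactors.card ≤ (NumberField.discr N).natAbs := by
      calc (NumberField.discr N).natAbs.primeFactors.card ≤ (Finset.Icc 1 (NumberField.discr N).natAbs).card :=
            Finset.card_le_card fun p hp ↦ Finset.mem_Icc.mpr
              ⟨(Nat.prime_of_mem_primeFactors hp).one_lt.le, Nat.le_of_mem_primeFactors hp⟩
        _ = (NumberField.discr N).natAbs := by simp
    have h2 : ((NumberField.discr N).natAbs : ℝ) ≤ Q := by rw [hQ]; exact natAbs_discr_le_condQn N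
    have h3 : (((NumberField.discr N).natAbs.primeFactors.card : ℕ) : ℝ) ≤ (NumberField.discr N).natAbs := by
      exact_mod_cast h1
    linarith
  -- weights are in `[0, 1]`
  have hw01 : ∀ (τ : N ≃ₐ[E] N) (wτ : Ideal (𝓞 E) → ℝ),
      (∀ I, wτ I = if (∃ v : HeightOneSpectrum (𝓞 E), Algebra.IsUnramifiedIn (𝓞 N) v.asIdeal ∧
        ∃ k : ℕ, I = v.asIdeal ^ k ∧ galFrob E N v ^ k = τ) then 1 else 0) →
      (∀ I, 0 ≤ wτ I) ∧ ∀ I, wτ I ≤ 1 := by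
    intro τ wτ hwτ
    exact ⟨fun I ↦ by rw [hwτ I]; split_ifs <;> norm_num, fun I ↦ by rw [hwτ I]; split_ifs <;> norm_num⟩
  -- common estimates at `x ≥ Q^{a₂}`
  have hcommon : ∀ x : ℝ, Q ^ a₂ ≤ x → Q ^ a₁ ≤ x ∧ 1 < x ∧
      (∀ (τ : N ≃ₐ[E] N) (wτ : Ideal (𝓞 E) → ℝ),
        (∀ I, wτ I = if (∃ v : HeightOneSpectrum (𝓞 E), Algebra.IsUnramifiedIn (𝓞 N) v.asIdeal ∧
          ∃ k : ℕ, I = v.asIdeal ^ k ∧ galFrob E N v ^ k = τ) then 1 else 0) →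
        (mN : ℝ) * |(∑ n ∈ Icc 0 ⌊x⌋₊, ∑ I ∈ idealsOfNorm E n, wτ I * idealVonMangoldt I) -
          (∑' n : ℕ, (∑ I ∈ idealsOfNorm E n, wτ I * idealVonMangoldt I) *
            tzTest (Real.log x) (x ^ (-ν)) (Real.log n))| ≤ η / 4 * x * m') ∧
      Real.sqrt x ≤ η / 64 * x * m' ∧ x ^ (-ν) * x ≤ η / 64 * x * m' ∧
      (n₀ : ℝ) * ((NumberField.discr N).natAbs.primeFactors.card) * (Real.log x + 1) ≤ η / 4 * x * m' ∧
      0 < x ^ (-ν) ∧ x ^ (-ν) ≤ 1 ∧ x ^ (-ν) < Real.log x / 2 ∧ 1 ≤ Real.log x := by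
    intro x hx
    have hxa₁ : Q ^ a₁ ≤ x := le_trans (Real.rpow_le_rpow_of_exponent_le hQ1.le ha₂a₁) hx
    have hxQ : Q ≤ x := by
      have : Q ^ (1 : ℝ) ≤ Q ^ a₂ := Real.rpow_le_rpow_of_exponent_le hQ1.le ha₂1
      rw [Real.rpow_one] at this; linarith
    have hx1 : 1 < x := by linarith
    have hx0 : 0 < x := by linarith
    set L : ℝ := Real.log x with hL
    have hLQ : a₂ * Real.log Q ≤ L := by
      have := Real.log_le_log (by positivity) hx
      rwa [Real.log_rpow (by linarith)] at this
    have hL2a : 2 * a₂ ≤ L := by nlinarith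
    have hL2 : 2 ≤ L := by linarith
    have hL0 : 0 < L := by linarith
    have hexpL : Real.exp L = x := by rw [hL, Real.exp_log hx0]
    set ε : ℝ := x ^ (-ν) with hε
    have hε0 : 0 < ε := Real.rpow_pos_of_pos hx0 _
    have hε1 : ε ≤ 1 := Real.rpow_le_one_of_one_le_of_nonpos hx1.le (by linarith)
    have hε1' : ε < 1 := Real.rpow_lt_one_of_one_lt_of_neg hx1 (by linarith)
    have hεL : ε < L / 2 := by linarith
    have hxe : Real.exp 1 ≤ x := by rw [← hexpL]; exact Real.exp_le_exp.2 (by linarith)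
    -- unsmoothing
    have hU : ∀ (τ : N ≃ₐ[E] N) (wτ : Ideal (𝓞 E) → ℝ),
        (∀ I, wτ I = if (∃ v : HeightOneSpectrum (𝓞 E), Algebra.IsUnramifiedIn (𝓞 N) v.asIdeal ∧
          ∃ k : ℕ, I = v.asIdeal ^ k ∧ galFrob E N v ^ k = τ) then 1 else 0) →
        (mN : ℝ) * |(∑ n ∈ Icc 0 ⌊x⌋₊, ∑ I ∈ idealsOfNorm E n, wτ I * idealVonMangoldt I) -
          (∑' n : ℕ, (∑ I ∈ idealsOfNorm E n, wτ I * idealVonMangoldt I) * tzTest L ε (Real.log n))| ≤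
          η / 4 * x * m' := by
      intro τ wτ hwτ
      obtain ⟨hw0, hw1⟩ := hw01 τ wτ hwτ
      have h1 := abs_psiWeighted_sub_smoothed_le (K := E) hw0 hw1 hx1 hε0 hε1
      have hlarge : 2 / ν * Real.log (44 * ((n₀ : ℝ) + 1) / (ν * (η / 4 * m'))) ≤ L := by
        have hcmp : 44 * ((n₀ : ℝ) + 1) / (ν * (η / 4 * m')) ≤ (176 * ((n₀ : ℝ) + 1) / (ν * η * c₁)) * Q ^ 6 := by
          rw [hm'2, div_le_iff₀ (by positivity)]
          have hQ4 : 1 ≤ Q ^ 4 := one_le_pow₀ hQ1.le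
          have e : 176 * ((n₀ : ℝ) + 1) / (ν * η * c₁) * Q ^ 6 * (ν * (η / 4 * (c₁ * (Q ^ 2)⁻¹))) =
              44 * (((n₀ : ℝ) + 1) * Q ^ 4) := by
            field_simp; ring
          rw [e]; nlinarith
        have hlogle : Real.log (44 * ((n₀ : ℝ) + 1) / (ν * (η / 4 * m'))) ≤ Λu + 6 * Real.log Q := by
          refine (Real.log_le_log (by positivity) hcmp).trans ?_
          rw [Real.log_mul (by positivity) (by positivity), Real.log_pow]
          push_cast
          linarith [le_max_right 0 (Real.log (176 * ((n₀ : ℝ) + 1) / (ν * η * c₁)))]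
        have h2ν : 0 < 2 / ν := by positivity
        calc 2 / ν * Real.log (44 * ((n₀ : ℝ) + 1) / (ν * (η / 4 * m')))
            ≤ 2 / ν * (Λu + 6 * Real.log Q) := mul_le_mul_of_nonneg_left hlogle h2ν.le
          _ ≤ 2 / ν * ((Λu + 6) * Real.log Q) := by
              refine mul_le_mul_of_nonneg_left ?_ h2ν.le
              nlinarith
          _ = 2 * (Λu + 6) / ν * Real.log Q := by ring
          _ ≤ a₂ * Real.log Q := mul_le_mul_of_nonneg_right ha₂u (by linarith)
          _ ≤ L := hLQ
      have hsmall := unsmoothing_small (n := (n₀ : ℝ)) (ν := ν) (η := η / 4 * m') (t := x)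
        (by positivity) hν0 (by linarith) (by positivity) hxe hlarge
      have hnE : (Module.finrank ℚ E : ℝ) * mN = n₀ := by rw [← hNn, hdeg]; push_cast; ring
      have h2 := mul_le_mul_of_nonneg_left h1 hm0
      have e1 : (mN : ℝ) * (Module.finrank ℚ E * ((Real.log x + 1) * (8 * Real.sqrt x + 2 * ε * x + 1))) =
          n₀ * ((Real.log x + 1) * (8 * Real.sqrt x + 2 * x ^ (-ν) * x + 1)) := by rw [← hnE, hε]; ring
      rw [e1] at h2
      exact h2.trans (hsmall.trans (le_of_eq (by ring)))
    -- the main-term errors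
    have hth := mul_rpow_neg_le_one_of_threshold (k := 2) (M := 64 / (η * c₁)) hQ12 hx hν0
      (by positivity) (by rw [← hΛm]; have := (div_le_iff₀ hν0).1 ha₂m; linarith)
    have hεm : ε ≤ η / 64 * m' := by
      rw [Real.rpow_two] at hth
      rw [hm'2, hε]
      have hMQ : 0 < 64 / (η * c₁) * Q ^ 2 := by positivity
      have h1 : x ^ (-ν) ≤ 1 / (64 / (η * c₁) * Q ^ 2) := by
        rw [le_div_iff₀ hMQ, mul_comm]; exact hth
      have h2 : 1 / (64 / (η * c₁) * Q ^ 2) = η / 64 * (c₁ * (Q ^ 2)⁻¹) := by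
        field_simp
      rw [← h2]; exact h1
    have hεx : ε * x ≤ η / 64 * x * m' := by
      have := mul_le_mul_of_nonneg_right hεm hx0.le; linarith
    have hsqrt : Real.sqrt x ≤ η / 64 * x * m' := by
      have h1 : Real.sqrt x = x ^ (-(1 / 2 : ℝ)) * x := by
        rw [Real.sqrt_eq_rpow, show (-(1 / 2 : ℝ)) = 1 / 2 - 1 by norm_num, Real.rpow_sub hx0,
          Real.rpow_one]
        field_simp
      have h2 : x ^ (-(1 / 2 : ℝ)) ≤ ε := Real.rpow_le_rpow_of_exponent_le hx1.le (by linarith)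
      rw [h1]
      have := mul_le_mul_of_nonneg_right (h2.trans hεm) hx0.le
      linarith
    -- the ramified junk: `n₀ ω (log x + 1) ≤ n₀ (2Q) (2 x^ν/ν) ≤ (η/4) x m'`
    have hJ : (n₀ : ℝ) * ((NumberField.discr N).natAbs.primeFactors.card) * (Real.log x + 1) ≤ η / 4 * x * m' := by
      have hν1 : 0 < 1 - ν := by linarith
      have hth' := mul_rpow_neg_le_one_of_threshold (k := 3) (M := 64 * n₀ / (ν * η * c₁)) hQ12 hx hν1
        (by positivity) (by rw [← hΛJ]; have := (div_le_iff₀ hν1).1 ha₂J; linarith)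
      -- `log x + 1 ≤ 2 log x ≤ 2 x^ν / ν`
      have hlogx : Real.log x + 1 ≤ 2 * (x ^ ν / ν) := by
        have h1 : Real.log x ≤ x ^ ν / ν := Real.log_le_rpow_div hx0.le hν0
        linarith
      have hxpow : x ^ (-(1 - ν)) * x = x ^ ν := by
        rw [show ν = -(1 - ν) + 1 by ring, Real.rpow_add hx0, Real.rpow_one]; ring_nf
      have h0 : (0 : ℝ) ≤ n₀ := Nat.cast_nonneg _
      calc (n₀ : ℝ) * ((NumberField.discr N).natAbs.primeFactors.card) * (Real.log x + 1)
          ≤ n₀ * (2 * Q) * (2 * (x ^ ν / ν)) :=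
            mul_le_mul (mul_le_mul_of_nonneg_left hω h0) hlogx (by linarith) (by positivity)
        _ = (64 * n₀ / (ν * η * c₁) * Q ^ (3 : ℝ) * x ^ (-(1 - ν))) * (η / 16 * x * (c₁ * (Q ^ 2)⁻¹)) * (Q ^ 2 * Q / Q ^ (3 : ℝ)) := by
            rw [← hxpow, show (Q ^ (3 : ℝ)) = Q ^ (3 : ℕ) by exact_mod_cast Real.rpow_natCast Q 3]
            field_simp
            ring
        _ ≤ 1 * (η / 16 * x * (c₁ * (Q ^ 2)⁻¹)) * (Q ^ 2 * Q / Q ^ (3 : ℝ)) := by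
            refine mul_le_mul_of_nonneg_right (mul_le_mul_of_nonneg_right hth' (by positivity)) ?_
            positivity
        _ = η / 16 * x * m' := by
            rw [hm'2, show (Q ^ (3 : ℝ)) = Q ^ (3 : ℕ) by exact_mod_cast Real.rpow_natCast Q 3]
            field_simp
        _ ≤ η / 4 * x * m' := by
            have : 0 ≤ η * x * m' := by positivity
            nlinarith
    exact ⟨hxa₁, hx1, hU, hsqrt, hεx, hJ, hε0, hε1, hεL, by linarith⟩
  have hβhalf_of : ∀ {cc β₁ : ℝ}, cc ≤ c →
      1 - cc / (Real.log ((NumberField.discr N).natAbs : ℝ) + Real.log 4) < β₁ → 1 / 2 ≤ β₁ := by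
    intro cc β₁ hcc hwin
    have hlog4 : 1 < Real.log 4 := by
      rw [show (4:ℝ) = 2 ^ 2 by norm_num, Real.log_pow]; have := Real.log_two_gt_d9; push_cast; linarith
    have hlogd : 0 ≤ Real.log ((NumberField.discr N).natAbs : ℝ) := Real.log_natCast_nonneg _
    have hc2 : cc ≤ 1 / 2 :=
      hcc.trans (hcn.trans (by rw [div_le_div_iff_of_pos_left one_pos (by positivity) (by norm_num)]; nlinarith))
    have : cc / (Real.log ((NumberField.discr N).natAbs : ℝ) + Real.log 4) ≤ 1 / 2 := by
      rw [div_le_iff₀ (by linarith)]; nlinarith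
    linarith
  have hBconv : ∀ β₁ : ℝ, dedekindZeta₁ N β₁ = 0 → β₁ < 1 → 1 / 2 ≤ β₁ → ∀ j₀ : ℕ,
      (∀ (τ : N ≃ₐ[E] N) (wτ : Ideal (𝓞 E) → ℝ),
          (∀ I, wτ I = if (∃ v : HeightOneSpectrum (𝓞 E), Algebra.IsUnramifiedIn (𝓞 N) v.asIdeal ∧
            ∃ k : ℕ, I = v.asIdeal ^ k ∧ galFrob E N v ^ k = τ) then 1 else 0) →
          ∀ x : ℝ, ThornerZaman.condQn N ^ a₁ ≤ x →
            ‖(mN : ℂ) *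
                  ((∑' k : ℕ, (∑ I ∈ idealsOfNorm E k, wτ I * idealVonMangoldt I) *
                    tzTest (Real.log x) (x ^ (-ν)) (Real.log k) : ℝ) : ℂ) -
                fordLaplace (tzTest (Real.log x) (x ^ (-ν))) (-1) +
                (((χ₁ τ : ℂˣ) : ℂ)⁻¹) ^ j₀ * fordLaplace (tzTest (Real.log x) (x ^ (-ν))) (-(β₁ : ℂ))‖ ≤
              η / 4 * x * min 1 ((1 - β₁) * Real.log x) +
                n₀ * ((NumberField.discr N).natAbs.primeFactors.card) * (Real.log x + 1)) →
      ∀ (τ : N ≃ₐ[E] N) (wτ : Ideal (𝓞 E) → ℝ),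
          (∀ I, wτ I = if (∃ v : HeightOneSpectrum (𝓞 E), Algebra.IsUnramifiedIn (𝓞 N) v.asIdeal ∧
            ∃ k : ℕ, I = v.asIdeal ^ k ∧ galFrob E N v ^ k = τ) then 1 else 0) →
          ∀ x : ℝ, Q ^ a₂ ≤ x →
            |(mN : ℝ) * (∑ n ∈ Icc 0 ⌊x⌋₊, ∑ I ∈ idealsOfNorm E n, wτ I * idealVonMangoldt I) -
                (x - ((((χ₁ τ : ℂˣ) : ℂ)⁻¹) ^ j₀).re * x ^ β₁ / β₁)| ≤
              η * x * min 1 ((1 - β₁) * Real.log x) := by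
    intro β₁ hζ hβ1 hβhalf j₀ hB τ wτ hwτ x hx
    have hβ1ne : ((β₁ : ℝ) : ℂ) ≠ 1 := by
      intro h'; apply hβ1.ne; exact_mod_cast h'
    have hLzero : classGroupLFunction N 1 β₁ = 0 := by
      have := classGroupLFunction_eq_zero_of_famF (K := N) 0 (ρ := (β₁ : ℂ)) (by rw [famF_zero]; exact hζ) hβ1ne
      rwa [toHomUnits_toMulHom_zero] at this
    have h11 : (1 : ClassGroup (𝓞 N) →* ℂˣ) * 1 = 1 := by ext; simp
    have hδlow : m' ≤ 1 - β₁ := heff N hNn 1 h11 β₁ hβ1 hLzero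
    obtain ⟨hxa₁, hx1, hU, hsqrt, hεx, hJ, hε0, hε1, hεL, hL1⟩ := hcommon x hx
    have hx0 : 0 < x := by linarith
    set mm : ℝ := min 1 ((1 - β₁) * Real.log x) with hmmdef
    have hδm : 1 - β₁ ≤ (1 - β₁) * Real.log x := by
      have := mul_le_mul_of_nonneg_left hL1 (by linarith : (0 : ℝ) ≤ 1 - β₁); linarith
    have hm'm : m' ≤ mm := le_min hm'1 (hδlow.trans hδm)
    have hmm0 : 0 ≤ mm := hm'0.le.trans hm'm
    have h1 := hB τ wτ hwτ x hxa₁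
    have h1' := (Complex.abs_re_le_norm _).trans h1
    have hFreal : (fordLaplace (tzTest (Real.log x) (x ^ (-ν))) (-(β₁ : ℂ))).im = 0 := by
      rw [fordLaplace_tzTest_ofReal (Real.log_pos hx1) hε0 β₁, Complex.ofReal_im]
    simp only [Complex.add_re, Complex.sub_re, Complex.mul_re, Complex.natCast_re, Complex.natCast_im,
      Complex.ofReal_re, Complex.ofReal_im, mul_zero, sub_zero, hFreal] at h1'
    have h2 := abs_re_fordLaplace_tzTest_neg_one_sub_le hx1 hε0 hε1 hεL
    have h4 := abs_re_fordLaplace_tzTest_neg_sub_le hx1 hε0 hε1 hεL hβhalf hβ1.le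
    have h3 := hU τ wτ hwτ
    have hθre : |((((χ₁ τ : ℂˣ) : ℂ)⁻¹) ^ j₀).re| ≤ 1 := by
      refine (Complex.abs_re_le_norm _).trans ?_
      rw [norm_pow]; exact pow_le_one₀ (norm_nonneg _) (norm_inv_character_le_one χ₁ τ)
    -- scale the junk bounds from `m'` to `mm`
    have h3m : (mN : ℝ) * |(∑ n ∈ Icc 0 ⌊x⌋₊, ∑ I ∈ idealsOfNorm E n, wτ I * idealVonMangoldt I) -
        (∑' n : ℕ, (∑ I ∈ idealsOfNorm E n, wτ I * idealVonMangoldt I) *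
          tzTest (Real.log x) (x ^ (-ν)) (Real.log n))| ≤ η / 4 * x * mm :=
      (h3).trans (mul_le_mul_of_nonneg_left hm'm (by positivity))
    have hsqrtm : Real.sqrt x ≤ η / 64 * x * mm := hsqrt.trans (mul_le_mul_of_nonneg_left hm'm (by positivity))
    have hεxm : x ^ (-ν) * x ≤ η / 64 * x * mm := hεx.trans (mul_le_mul_of_nonneg_left hm'm (by positivity))
    have hJm : (n₀ : ℝ) * ((NumberField.discr N).natAbs.primeFactors.card) * (Real.log x + 1) ≤ η / 4 * x * mm :=
      hJ.trans (mul_le_mul_of_nonneg_left hm'm (by positivity))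
    set mt : ℝ := x ^ β₁ / β₁ with hmtdef
    have hD : |(mN : ℝ) * ((∑ n ∈ Icc 0 ⌊x⌋₊, ∑ I ∈ idealsOfNorm E n, wτ I * idealVonMangoldt I) -
        (∑' n : ℕ, (∑ I ∈ idealsOfNorm E n, wτ I * idealVonMangoldt I) *
          tzTest (Real.log x) (x ^ (-ν)) (Real.log n)))| ≤ η / 4 * x * mm := by
      rw [abs_mul, abs_of_nonneg hm0]; exact h3m
    have hD' := abs_le.1 hD
    set r : ℝ := ((((χ₁ τ : ℂˣ) : ℂ)⁻¹) ^ j₀).re with hr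
    set Fβ : ℝ := (fordLaplace (tzTest (Real.log x) (x ^ (-ν))) (-(β₁ : ℂ))).re with hFβ
    have hprod : |r * Fβ - r * mt| ≤ 2 * Real.sqrt x + 4 * x ^ (-ν) * x := by
      rw [← mul_sub, abs_mul]
      calc |r| * |Fβ - mt| ≤ 1 * (2 * Real.sqrt x + 4 * x ^ (-ν) * x) :=
            mul_le_mul hθre h4 (abs_nonneg _) zero_le_one
        _ = _ := one_mul _
    have hprod' := abs_le.1 hprod
    rw [abs_le] at h1' h2 ⊢
    have hηxm : 0 ≤ η * x * mm := by positivity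
    rw [hmtdef] at hprod'
    rw [mul_div_assoc]
    constructor <;> linarith [hD'.1, hD'.2, h1'.1, h1'.2, h2.1, h2.2, hprod'.1, hprod'.2, hsqrtm, hεxm, hJm]
  refine ⟨χ₁, hχ₁, fun τ wτ hwτ x hx hnoexc ↦ ?_, fun β₁ hζ hwin hβ1 ↦ ?_, fun β₁ hζ hwin hβ1 ↦ ?_⟩
  · -- no exceptional zero
    obtain ⟨hxa₁, hx1, hU, hsqrt, hεx, hJ, hε0, hε1, hεL, -⟩ := hcommon x hx
    have hx0 : 0 < x := by linarith
    have h1 := hcaseA τ wτ hwτ x hxa₁ hnoexc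
    have h1' := (Complex.abs_re_le_norm _).trans h1
    simp only [Complex.sub_re, Complex.mul_re, Complex.natCast_re, Complex.natCast_im,
      Complex.ofReal_re, Complex.ofReal_im, mul_zero, sub_zero] at h1'
    have h2 := abs_re_fordLaplace_tzTest_neg_one_sub_le hx1 hε0 hε1 hεL
    have h3 := hU τ wτ hwτ
    have hm'x : η / 4 * x * m' ≤ η / 4 * x := by
      have := mul_le_mul_of_nonneg_left hm'1 (by positivity : (0 : ℝ) ≤ η / 4 * x); linarith
    have hm'x' : η / 64 * x * m' ≤ η / 64 * x := by
      have := mul_le_mul_of_nonneg_left hm'1 (by positivity : (0 : ℝ) ≤ η / 64 * x); linarith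
    have hD : |(mN : ℝ) * ((∑ n ∈ Icc 0 ⌊x⌋₊, ∑ I ∈ idealsOfNorm E n, wτ I * idealVonMangoldt I) -
        (∑' n : ℕ, (∑ I ∈ idealsOfNorm E n, wτ I * idealVonMangoldt I) *
          tzTest (Real.log x) (x ^ (-ν)) (Real.log n)))| ≤ η / 4 * x := by
      rw [abs_mul, abs_of_nonneg hm0]; exact (h3.trans hm'x)
    have hD' := abs_le.1 hD
    rw [abs_le] at h1' h2 ⊢
    have hηx : 0 < η * x := mul_pos hη hx0
    constructor <;> nlinarith [hD'.1, hD'.2, h1'.1, h1'.2, h2.1, h2.2, hsqrt, hεx, hJ, hm'1, hm'0]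
  · -- the exceptional zero
    obtain ⟨j₀, hj₀m, hB⟩ := hcaseB β₁ hζ hwin hβ1
    exact ⟨j₀, hj₀m, hBconv β₁ hζ hβ1 (hβhalf_of le_rfl hwin) j₀ hB⟩
  · -- the exceptional zero in the `c'`-window, with the sign
    obtain ⟨j₀, hj₀m, hiff, hsq, hB⟩ := hcaseB' β₁ hζ hwin hβ1
    exact ⟨j₀, hj₀m, hiff, hsq, hBconv β₁ hζ hβ1 (hβhalf_of hc'c hwin) j₀ hB⟩

end Summit.QuantumAdvantage.QuantumAdvantage.Theorems.DegreeOnePrimesEscape
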